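import Literature.Geometry.Kaehler.DolbeaultChartAcyclic
import HarnessLib

/-!
# Extension by zero of real forms on an open submanifold (real model spaces)

Topic `Literature/Geometry/Kaehler` (manifold forms).  The tree's
`Literature.Geometry.Kaehler.MForm.extendOpens` (`DolbeaultChartAcyclic.lean`) extends a form on
an open submanifold `↥U` by zero to the ambient manifold, but is stated for complex model spaces
and complex coefficients (its home is the Dolbeault complex), and two of its supporting lemmas
(`eventually_contMDiffAt_opensRetract`, `mfderiv_opensRetract`) carry the ambient
`[NormedSpace ℂ E]` section variable.  This file records the same construction for a real model
space `E` and arbitrary real coefficients `F` — `MForm.extendOpensReal` — with the same API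
(`…_apply_of_mem`, `…_apply_of_notMem`, `smoothAt_extendOpensReal`, smoothness off the closure of
the support), following the tree's proofs line by line.  It is the plumbing of the cut-off Stokes
computation in the fact seat of
`Literature.Geometry.Symplectic.mclean_divisorComplement_convex_four` (McLean 2012, Lemma 5.17),
where the `3`-form `χ · θ' ∧ ω`, defined on the divisor complement `U`, is extended by zero
across the divisor.

Everything is proved; no named facts (D-0026).

## References

* M. McLean, *The growth rate of symplectic homology and affine varieties*, GAFA 22 (2012),
  Lemma 5.17. [Mclean2012]
* F. W. Warner, *Foundations of Differentiable Manifolds and Lie Groups* (1983), 1.9–1.11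
  (extension by zero / bump functions). [Warner1983]
-/

noncomputable section

open scoped Manifold ContDiff Topology
open Set Function Filter TopologicalSpace

namespace Literature.Geometry.Kaehler

variable {E : Type*} [NormedAddCommGroup E] [NormedSpace ℝ E]
  {F : Type*} [NormedAddCommGroup F] [NormedSpace ℝ F]
  {M : Type*} [TopologicalSpace M] [ChartedSpace E M]
  {U : Opens M} {w₀ : U} {k : ℕ}

/-- The retraction onto an open submanifold is `C^∞` near every point of `U` (real model).
[folklore] -/
theorem eventually_contMDiffAt_opensRetract_real {m : M} (hm : m ∈ U) :
    ∀ᶠ z in 𝓝 m, ContMDiffAt 𝓘(ℝ, E) 𝓘(ℝ, E) ∞ (opensRetract U w₀) z := by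
  filter_upwards [U.isOpen.mem_nhds hm] with z hz
  exact contMDiffAt_opensRetract hz

/-- **The retraction has identity differential at the points of `U`** (real model).
[folklore] -/
theorem mfderiv_opensRetract_real {m : M} (hm : m ∈ U) :
    mfderiv 𝓘(ℝ, E) 𝓘(ℝ, E) (opensRetract U w₀) m = ContinuousLinearMap.id ℝ E := by
  have hr : MDifferentiableAt 𝓘(ℝ, E) 𝓘(ℝ, E) (opensRetract U w₀) m :=
    (contMDiffAt_opensRetract hm).mdifferentiableAt (by simp)
  have hval : HasMFDerivAt 𝓘(ℝ, E) 𝓘(ℝ, E) (Subtype.val : U → M) (opensRetract U w₀ m)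
      (ContinuousLinearMap.id ℝ E) :=
    Literature.Geometry.Manifold.OpenSubmanifold.hasMFDerivAt_subtype_val _
  have hcomp : HasMFDerivAt 𝓘(ℝ, E) 𝓘(ℝ, E) (Subtype.val ∘ opensRetract U w₀) m
      ((ContinuousLinearMap.id ℝ E).comp (mfderiv 𝓘(ℝ, E) 𝓘(ℝ, E) (opensRetract U w₀) m)) :=
    hval.comp m hr.hasMFDerivAt
  have hid : HasMFDerivAt 𝓘(ℝ, E) 𝓘(ℝ, E) (Subtype.val ∘ opensRetract U w₀) m
      (ContinuousLinearMap.id ℝ (TangentSpace 𝓘(ℝ, E) m)) :=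
    (hasMFDerivAt_id m).congr_of_eventuallyEq (val_comp_opensRetract_eventuallyEq hm)
  have h := hcomp.mfderiv.symm.trans hid.mfderiv
  rw [ContinuousLinearMap.id_comp] at h
  exact h

/-- **Extension by zero** of a real-coefficient form on the open submanifold `↥U` to a form on
`M` (real model space): the pull-back along the retraction, cut off to `U`. [folklore] -/
def MForm.extendOpensReal (β : MForm 𝓘(ℝ, E) U F k) (w₀ : U) : MForm 𝓘(ℝ, E) M F k :=
  (β.pullback 𝓘(ℝ, E) (opensRetract U w₀)).restr (U : Set M)

/-- At a point of `U` the extension is the form. [folklore] -/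
theorem MForm.extendOpensReal_apply_of_mem (β : MForm 𝓘(ℝ, E) U F k) {m : M} (hm : m ∈ U)
    (v : Fin k → TangentSpace 𝓘(ℝ, E) m) :
    β.extendOpensReal w₀ m v = β ⟨m, hm⟩ v := by
  rw [MForm.extendOpensReal, MForm.restr_apply_of_mem _ hm, MForm.pullback_apply,
    mfderiv_opensRetract_real hm, opensRetract_of_mem hm]
  rfl

/-- Off `U` the extension vanishes. [folklore] -/
theorem MForm.extendOpensReal_apply_of_notMem (β : MForm 𝓘(ℝ, E) U F k) {m : M}
    (hm : m ∉ (U : Set M)) : β.extendOpensReal w₀ m = 0 :=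
  MForm.restr_apply_of_notMem _ hm

/-- Restricting the extension back to `↥U` gives the form. [folklore] -/
theorem MForm.pullback_subtypeVal_extendOpensReal (β : MForm 𝓘(ℝ, E) U F k) :
    (β.extendOpensReal w₀).pullback 𝓘(ℝ, E) (Subtype.val : U → M) = β := by
  funext w
  ext v
  rw [MForm.pullback_subtypeVal_apply, MForm.extendOpensReal_apply_of_mem β w.2]

variable [IsManifold 𝓘(ℝ, E) ∞ M]

/-- The extension is smooth at the points of `U` where the form is. [folklore] -/
theorem MForm.smoothAt_extendOpensReal {β : MForm 𝓘(ℝ, E) U F k} {m : M} (hm : m ∈ U)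
    (hβ : β.SmoothAt ⟨m, hm⟩) : (β.extendOpensReal w₀).SmoothAt m := by
  refine (MForm.smoothAt_restr_iff U.isOpen _ hm).2 ?_
  refine MForm.SmoothAt.pullback (eventually_contMDiffAt_opensRetract_real hm) ?_
  rwa [opensRetract_of_mem hm]

omit [IsManifold 𝓘(ℝ, E) ∞ M] in
/-- The extension is smooth at every point having a neighbourhood on which it vanishes off `U`
and the form vanishes on `U` — in particular at the points off the closure of the support: if
`β w = 0` for all `w ∈ U` near `m`, then the extension is `0` near `m`, hence smooth there.
[folklore] -/
theorem MForm.smoothAt_extendOpensReal_of_eventually_eq_zero {β : MForm 𝓘(ℝ, E) U F k} {m : M}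
    (h : ∀ᶠ z in 𝓝 m, ∀ hz : z ∈ U, β ⟨z, hz⟩ = 0) : (β.extendOpensReal w₀).SmoothAt m := by
  have hev : ∀ᶠ z in 𝓝 m, β.extendOpensReal w₀ z = (0 : MForm 𝓘(ℝ, E) M F k) z := by
    filter_upwards [h] with z hz
    by_cases hzU : z ∈ U
    · ext v
      rw [MForm.extendOpensReal_apply_of_mem β hzU, hz hzU]
      rfl
    · exact MForm.extendOpensReal_apply_of_notMem β hzU
  exact (MForm.smoothAt_congr_of_eventuallyEq hev).2 (isSmoothForm_zero m)

end Literature.Geometry.Kaehler
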